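import Summits.BirchSwinnertonDyer.BirchSwinnertonDyer.Theorems.CMKolyvaginAtInertTwoStarDoorOneBitBSDTwoOfPrintedInputs
import Summits.BirchSwinnertonDyer.BirchSwinnertonDyer.Theorems.CMKolyvaginAtInertTwoCertificateOneBitBSDTwoOfPrintedInputs
import Literature.NumberTheory.EllipticCurves.ManinConstantSemistablePrimewise
import HarnessLib

/-!
# Route `CMKolyvaginAtInertTwo` (leaf `WAllCornerFTwo`, habitat H₂): ON THE GOOD SLICE `2 ∤ N_E` THE ODD-MANIN BINDER IS PRINT (Abbes–Ullmo) —
# the certificate-level class and the (★)-door with `Odd Dt.c` discharged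

Seat `bsd-line-cmk2-p1` g22 (cell `bsd-print-cf2`), `--supports stmt-BirchSwinnertonDyer-28663` (helper; closes nothing by name).
THEOREMS ONLY (no definition, no named fact, no `sorry`).  BSD is NOT proved by this.

Every H₂ class theorem of the line carries the frame binders `hopt` (the lattice clause `Λ_E ⊆ c·Λ_f`: the parametrisation `Dt` is the
OPTIMAL one) and `hc : Odd Dt.c` (its Manin constant is odd).  On the slice InertGood (`2 ∤ N_E`, i.e. `E` good — supersingular — at `2`)
the second follows from the first by PRINT: Abbes–Ullmo 1996, Thm. A («`p ∤ N ⟹ p ∤ c`» for the `X₀(N)`-optimal curve), typed in the tree as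
the named fact `ModularForms.abbesUllmo_not_dvd_maninConstant_of_not_dvd_level` in exactly the lattice-clause shape of `hopt`
(`Dt.maninConstant = Dt.c` by definition).  Hence:

* `odd_c_of_abbesUllmo_of_not_two_dvd_conductorNorm` — `hopt` + Abbes–Ullmo + `2 ∤ N_W` ⟹ `Odd Dt.c`.
* `bsdp_two_of_exists_certificate_inertGood_of_printedInputs` — the certificate-level one-bit class theorem (p762853) on InertGood with
  `Odd Dt.c` replaced by the Abbes–Ullmo print.
* `bsdp_two_of_assumptionStar_inertGood_of_printedInputs` — the conductor-free (★)-door (p763542/p764018) on InertGood, likewise; here also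
  `c₂(W) = 1`-type input is not needed (the primed door already derives odd `c₂` from the odd Tamagawa product).

On InertBad (`2 ∣ N_E`, additive `2`: `4 ∣ N_E`) no printed Manin statement applies (Mazur: odd `p`; Česnavičius 2018: `2 ∥ N`), so the binder
stays there.  HONEST FRAMING: one MORE print (Abbes–Ullmo) in exchange for one binder; everything else as in the cited files.  BSD is NOT proved by
this; no item is closed by this file.

References: [AbbesUllmo1996] Thm. A; [EdixhovenManin1991] §1, Prop. 2; [KrizLi2019] Lemma 5.4 (their use of Abbes–Ullmo at good `2`);
[McCallumLMS1991] §5 Thm. 5.4; [BurungaleFlach2024] Thm. 1.1, Cor. 2.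
-/

set_option autoImplicit false
-- the Theorems namespace of this sub repeats the summit name by design (D-0017 nested layout)
set_option linter.dupNamespace false

noncomputable section

open scoped Classical

open WeierstrassCurve NumberField Literature.NumberTheory.EllipticCurves
  Literature.NumberTheory.EllipticCurves.ModularForms
  Literature.NumberTheory.EllipticCurves.Rank1Residual
  Literature.NumberTheory.EllipticCurves.KrizLi2019
  Summit.BirchSwinnertonDyer.Rank1Residual
open Literature.NumberTheory.EllipticCurves.GrossLMS1991 (prop37_2_reductionCongruence_inert)

namespace Summit.BirchSwinnertonDyer.BirchSwinnertonDyer.Theorems.KolyvaginLowerTwo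

/-- **Odd Manin constant on the good slice, from Abbes–Ullmo.**  For `W/ℚ` globally minimal, a parametrisation datum `Dt` at level `N_W`
with the lattice clause (`Dt` optimal), and `2 ∤ N_W`: Abbes–Ullmo's Thm. A (named fact) gives `2 ∤ Dt.c`, i.e. `Odd Dt.c`.
[cite: AbbesUllmo1996, Thm. A] [cite: EdixhovenManin1991, Prop. 2] -/
theorem odd_c_of_abbesUllmo_of_not_two_dvd_conductorNorm (hAU : abbesUllmo_not_dvd_maninConstant_of_not_dvd_level)
    (W : WeierstrassCurve ℚ) [W.IsElliptic] [W.IsGloballyMinimal] [NeZero (W.conductorNorm ℤ)]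
    (Dt : ModularParametrizationData W (W.conductorNorm ℤ))
    (hopt : ∀ z ∈ Dt.L.lattice, ∃ w ∈ periodLattice Dt.f, z = (Dt.c : ℂ) * w) (h2N : ¬ 2 ∣ W.conductorNorm ℤ) :
    Odd Dt.c := by
  have h := hAU W Dt hopt 2 Nat.prime_two h2N
  refine Int.not_even_iff_odd.mp fun he ↦ h ?_
  exact_mod_cast even_iff_two_dvd.mp he

/-- **The certificate-level one-bit class theorem on InertGood, Manin binder discharged by Abbes–Ullmo.**  As
`bsdp_two_of_exists_certificate_of_sum_defect_le_one_of_printedInputs` (p762853) with `Odd Dt.c` replaced by the print + `2 ∤ N_W`.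
[cite: AbbesUllmo1996, Thm. A] [cite: McCallumLMS1991, §5 Thm. 5.4] [cite: BurungaleFlach2024, Thm. 1.1 and Cor. 2] [cite: GrossLMS1991, Prop. 3.7 (2)] -/
theorem bsdp_two_of_exists_certificate_inertGood_of_printedInputs
    (hGZ : ∀ (N : ℕ) [NeZero N] (W : WeierstrassCurve ℚ) (K : Type) [Field K] [NumberField K], gross_zagier N W K)
    (hGZK : rank_eq_analyticRank_of_analyticRank_le_one) (hnf : exists_isNewformOf)
    (hMilneC : Milne1972.bsdQuotient_baseChange_quadratic_anyModel) (hBF : bsdTriple_of_hasCM_of_L_one_ne_zero)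
    (hAU : abbesUllmo_not_dvd_maninConstant_of_not_dvd_level)
    (W : WeierstrassCurve ℚ) [W.IsElliptic] [W.IsGloballyMinimal] [NeZero (W.conductorNorm ℤ)]
    (hCM : W.HasCM) (hin : Rank1Residual.CMInert W 2) (hρ2 : W.HasSurjectiveModNGaloisRep 2) (hr : W.analyticRank = 1)
    (hT : Odd W.tamagawaProduct) (h2N : ¬ 2 ∣ W.conductorNorm ℤ)
    (K : Type) [Field K] [NumberField K] (hIQ : IsImaginaryQuadratic K)
    (hodd : Odd (NumberField.discr K)) (h3 : NumberField.discr K ≠ -3) (hHe : SatisfiesHeegnerHypothesis (W.conductorNorm ℤ) K)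
    (hdef : ∑ q ∈ (NumberField.discr K).natAbs.primeFactors,
        ((if jacobiSym W.Δ.num q = -1 then 1 else 0) +
          (if jacobiSym W.Δ.num q = 1 ∧ Even (W.frobeniusTrace q) then 2 else 0)) ≤ 1)
    (h37 : prop37_2_reductionCongruence_inert (W.conductorNorm ℤ) W K)
    (Dt : ModularParametrizationData W (W.conductorNorm ℤ))
    (hopt : ∀ z ∈ Dt.L.lattice, ∃ w ∈ periodLattice Dt.f, z = (Dt.c : ℂ) * w)
    (β : ℤ) (ι : K →+* ℂ) (d₁ : KolyvaginHeegnerData Dt β ι 1) (hy : ¬ IsOfFinAddOrder d₁.derivedPoint)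
    (hcert : ∃ (n : ℕ) (d : KolyvaginHeegnerData Dt β ι n), Squarefree n ∧
      (∀ ℓ ∈ n.primeFactors, Zhang2014.IsKolyvaginPrime (W.conductorNorm ℤ) W K 2 ℓ ∧ Rank1Residual.CMInert W ℓ) ∧
      ¬ ∃ Q : (W.baseChange (ringClassField K ι n)).toAffine.Point, (2 : ℤ) • Q = d.derivedPoint) :
    BSDp W 2 :=
  bsdp_two_of_exists_certificate_of_sum_defect_le_one_of_printedInputs hGZ hGZK hnf hMilneC hBF W hCM hin hρ2 hr hT K hIQ hodd h3 hHe hdef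
    h37 Dt hopt (odd_c_of_abbesUllmo_of_not_two_dvd_conductorNorm hAU W Dt hopt h2N) β ι d₁ hy hcert

/-- **The conductor-free (★)-door on InertGood, Manin binder discharged by Abbes–Ullmo** (and `c₂` by the odd Tamagawa product).  As
`bsdp_two_of_assumptionStar_of_sum_defect_le_one_of_printedInputs'` (p764018) with `Odd Dt.c` replaced by the print + `2 ∤ N_W`.
[cite: AbbesUllmo1996, Thm. A] [cite: KrizLi2019, Thm. 1.12 (FMS) and Lemma 5.4] [cite: BurungaleFlach2024, Thm. 1.1 and Cor. 2] -/
theorem bsdp_two_of_assumptionStar_inertGood_of_printedInputs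
    (hGZ : ∀ (N : ℕ) [NeZero N] (W : WeierstrassCurve ℚ) (K : Type) [Field K] [NumberField K], gross_zagier N W K)
    (hGZK : rank_eq_analyticRank_of_analyticRank_le_one) (hnf : exists_isNewformOf)
    (hMilneC : Milne1972.bsdQuotient_baseChange_quadratic_anyModel) (hBF : bsdTriple_of_hasCM_of_L_one_ne_zero)
    (hAU : abbesUllmo_not_dvd_maninConstant_of_not_dvd_level)
    (W : WeierstrassCurve ℚ) [W.IsElliptic] [W.IsGloballyMinimal] [NeZero (W.conductorNorm ℤ)]
    (hCM : W.HasCM) (hin : Rank1Residual.CMInert W 2) (hρ2 : W.HasSurjectiveModNGaloisRep 2) (hr : W.analyticRank = 1)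
    (hT : Odd W.tamagawaProduct) (h2N : ¬ 2 ∣ W.conductorNorm ℤ)
    (K : Type) [Field K] [NumberField K] (hIQ : IsImaginaryQuadratic K)
    (hodd : Odd (NumberField.discr K)) (h3 : NumberField.discr K ≠ -3) (hHe : SatisfiesHeegnerHypothesis (W.conductorNorm ℤ) K)
    (hdef : ∑ q ∈ (NumberField.discr K).natAbs.primeFactors,
        ((if jacobiSym W.Δ.num q = -1 then 1 else 0) +
          (if jacobiSym W.Δ.num q = 1 ∧ Even (W.frobeniusTrace q) then 2 else 0)) ≤ 1)
    (h37 : prop37_2_reductionCongruence_inert (W.conductorNorm ℤ) W K)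
    (Dt : ModularParametrizationData W (W.conductorNorm ℤ))
    (hopt : ∀ z ∈ Dt.L.lattice, ∃ w ∈ periodLattice Dt.f, z = (Dt.c : ℂ) * w)
    (β : ℤ) (ι : K →+* ℂ) (d₁ : KolyvaginHeegnerData Dt β ι 1) (P₀ : (W.baseChange K).toAffine.Point)
    (hP₀K : WeierstrassCurve.Affine.Point.map (W' := W) (algebraMap K (ringClassField K ι 1)).toRatAlgHom P₀ = d₁.derivedPoint)
    (j : K →ₐ[ℚ] ℚ_[2]) (hstar : AssumptionStar W Dt K P₀ j) :
    BSDp W 2 :=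
  bsdp_two_of_assumptionStar_of_sum_defect_le_one_of_printedInputs' hGZ hGZK hnf hMilneC hBF W hCM hin hρ2 hr hT K hIQ hodd h3 hHe hdef h37
    Dt hopt (odd_c_of_abbesUllmo_of_not_two_dvd_conductorNorm hAU W Dt hopt h2N) β ι d₁ P₀ hP₀K j hstar

end Summit.BirchSwinnertonDyer.BirchSwinnertonDyer.Theorems.KolyvaginLowerTwo

end
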